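import Literature.NumberTheory.LFunctions.RobinAnalyticRH
import Literature.NumberTheory.LFunctions.FordZetaZeroRecipSqSum
import Literature.NumberTheory.DiophantineGeometry.NamedHypotheses
import Summits.RiemannHypothesis.RiemannHypothesis.Theorems.Splittings.LiIndexSetsSyndetic
import HarnessLib

/-!
# Splittings — Robin finite lens, E1c⁻ part 2/4: the PARTIAL-RH ZERO SPLIT of Nicolas's zero sum `Σ_ρ (m/ρ)F_ρ(x)`
# (SPLIT-robin-finite gen 5; zero-definition raw form)

Cell rh-split, seat rh-split-robin-finite g5 (brief sha16 f79c5f09d8bcb036), card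
`run/shared/lean/pub/rh-split/cards/SPLIT-robin-finite.md` §12; zero-definition raw form of
`HOME/rh-split-robin-finite/SketchG5-E1c.lean` (sha16 a141f2e32dd4cace; referee CONTENT REPLAY PASS rh-split-ref g2
2026-08-27T03:02:44Z: farm rc 0 / 0 warn / 0 sorry, std axioms on `E1c.partialNicolasLower_PT`,
`E1c.nicolasLowerBetween_PT`, `E1c.schoenfeldThetaOn_of_buthe2016`), filed by rh-split-typer-1 g4.  The scratch's 15
interface `def`s (`nicolasEWith`, `SchoenfeldThetaOn`, `OffLineSumAt`, `budgetPw`, `PartialExplicitCorePwLower`,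
`ExplicitFormulaFree`, `ZeroSplitBound`, `PsiSubThetaFree`, `termSum`, `OffLineSumOn`, `NicolasLowerBetween`,
`PartialNicolasBetween`, `ZeroTailBound`, `lehmanH`, `lehmanTail`) are SPELLED OUT VERBATIM at every site; proofs are the
scratch's, with only the `unfold`/`rw` steps of the spelled-out abbreviations removed.
Dedup-and-cite: the scratch's `E1c.re_eq_half_of_abs_im_le` (subtype `Zeros` version) is NOT re-declared — the landed
`Splittings.LiIndexSets.re_eq_half_of_abs_im_le` (LiIndexSetsSyndetic, set-membership version) is applied to `ρ.2` at the
single use site in `zeroSplitBound_holds` (referee instruction (ii)).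
HONEST LABEL: «SPLITTING SEARCH over kernel-typed RH-EQUIVALENCES; a splitting A ∧ B ⟹ RH is CONDITIONAL bookkeeping
unless A and B are both proved; nothing here bears on the truth of RH.»

This part: S2 of the seam census — where `RiemannHypothesis` enters the tree's proof of (2.18) through the zeros' bracket
(`NicolasJExplicit.zeros_bracket hRH`), here RH up to height `T` enters ONLY through the on-line identification of the
zeros with `|γ| ≤ T` (`LiIndexSets.re_eq_half_of_abs_im_le`: `RiemannHypothesisUpTo T` + `riemannZeta_conj`); on-line zeros
are weighed by Ford's RH-free `Σ m/|ρ|² ≤ 0.0463` (`tsum_zeroOrder_div_norm_sq_le`), EVERY other zero by the RH-free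
per-zero bound `‖F_ρ(x)/ρ‖ ≤ x^{β−1}(1/(|ρ||1−ρ| log x) + 2/(|1−ρ|² log² x))` (`norm_Fz_div_le_offline`: Nicolas 2012
Lemma 2.2 off the line, two integrations by parts + `∫_x^∞ dt/(t log³t) = 1/(2 log²x)`, uniform in `β`) and the
hypothesis `Σ_{|γ|>T} m x^{β−1/2}/γ² ≤ D` (scratch `OffLineSumAt T x D`, spelled out).  Headline `zeroSplitBound_holds`
(scratch `ZeroSplitBound`, spelled out).  Everything except the on-line identification is RH-free.
-/

set_option linter.dupNamespace false

noncomputable section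

open Complex Filter Set MeasureTheory Topology intervalIntegral
open scoped Real Chebyshev ComplexConjugate

namespace Summit.RiemannHypothesis.RiemannHypothesis.Theorems.Splittings.RobinFiniteE1c

open Literature.NumberTheory.LFunctions Literature.NumberTheory.DiophantineGeometry
open NicolasJ NicolasFz NicolasK NicolasJExplicit

/-! ### RH-free per-zero bounds (Nicolas 2012 Lemma 2.2 off the line) -/

/-- `t ↦ −1/(2 log² t)` has derivative `1/(t log³ t)` at `t > 1`. [folklore] -/
theorem hasDerivAt_inv_log_sq {t : ℝ} (ht : 1 < t) :
    HasDerivAt (fun u : ℝ ↦ -(1 / 2) * (Real.log u ^ 2)⁻¹) (t⁻¹ * (Real.log t ^ 3)⁻¹) t := by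
  have ht0 : t ≠ 0 := by positivity
  have hlt : Real.log t ≠ 0 := (Real.log_pos ht).ne'
  have h1 : HasDerivAt (fun u : ℝ ↦ Real.log u ^ 2) (((2 : ℕ) : ℝ) * Real.log t ^ (2 - 1) * t⁻¹) t :=
    (Real.hasDerivAt_log ht0).pow 2
  have h2 := (h1.inv (pow_ne_zero 2 hlt)).const_mul (-(1 / 2) : ℝ)
  refine h2.congr_deriv ?_
  have hl2 : Real.log t ^ 2 ≠ 0 := pow_ne_zero 2 hlt
  norm_num
  field_simp

/-- `∫_x^∞ dt/(t log³ t) = 1/(2 log² x)` for `x > 1`, with integrability. [folklore] -/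
theorem integral_Ioi_inv_mul_inv_log_cube {x : ℝ} (hx : 1 < x) :
    IntegrableOn (fun t : ℝ ↦ t⁻¹ * (Real.log t ^ 3)⁻¹) (Ioi x) ∧
    ∫ t in Ioi x, t⁻¹ * (Real.log t ^ 3)⁻¹ = 1 / (2 * Real.log x ^ 2) := by
  have hderiv : ∀ t ∈ Ici x, HasDerivAt (fun u : ℝ ↦ -(1 / 2) * (Real.log u ^ 2)⁻¹)
      (t⁻¹ * (Real.log t ^ 3)⁻¹) t := fun t ht ↦ hasDerivAt_inv_log_sq (hx.trans_le ht)
  have hpos : ∀ t ∈ Ioi x, 0 ≤ t⁻¹ * (Real.log t ^ 3)⁻¹ := by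
    intro t ht
    have ht1 : 1 < t := hx.trans ht
    have : 0 < Real.log t := Real.log_pos ht1
    positivity
  have hlim : Tendsto (fun u : ℝ ↦ -(1 / 2) * (Real.log u ^ 2)⁻¹) atTop (𝓝 0) := by
    have h := (Real.tendsto_log_atTop.comp tendsto_id)
    have h2 : Tendsto (fun u : ℝ ↦ Real.log u ^ 2) atTop atTop :=
      (tendsto_pow_atTop two_ne_zero).comp Real.tendsto_log_atTop
    have h3 := h2.inv_tendsto_atTop
    simpa using h3.const_mul (-(1 / 2) : ℝ)
  refine ⟨integrableOn_Ioi_deriv_of_nonneg' hderiv hpos hlim, ?_⟩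
  rw [integral_Ioi_of_hasDerivAt_of_nonneg' hderiv hpos hlim]
  have hlx : Real.log x ≠ 0 := (Real.log_pos hx).ne'
  field_simp
  ring

/-- `‖∫_x^∞ c·t^{z−2}/log³t dt‖ ≤ ‖c‖·x^{Re z−1}/(2 log²x)` for `Re z ≤ 1`, `x > 1` — uniform in `Re z`
(`t^{Re z−2} ≤ x^{Re z−1}·t⁻¹` for `t ≥ x`), unlike the tree's `norm_integral_cpow_div_log_pow_le`
(factor `1/(1 − Re z)`). [folklore] -/
theorem norm_integral_cpow_div_log_cube_le {z : ℂ} {x : ℝ} (hz : z.re < 1) (hx : 1 < x) (c : ℂ) :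
    ‖∫ t in Ioi x, c * ((t : ℂ) ^ (z - 2) * ((1 / Real.log t ^ 3 : ℝ) : ℂ))‖ ≤
      ‖c‖ * (x ^ (z.re - 1) / (2 * Real.log x ^ 2)) := by
  have hx0 : 0 < x := by linarith
  have hlx : 0 < Real.log x := Real.log_pos hx
  obtain ⟨hint, hval⟩ := integral_Ioi_inv_mul_inv_log_cube hx
  have hbound : ∀ t ∈ Ioi x, ‖c * ((t : ℂ) ^ (z - 2) * ((1 / Real.log t ^ 3 : ℝ) : ℂ))‖ ≤
      ‖c‖ * x ^ (z.re - 1) * (t⁻¹ * (Real.log t ^ 3)⁻¹) := by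
    intro t ht
    have ht0 : 0 < t := hx0.trans ht
    have ht1 : 1 < t := hx.trans ht
    have hlt : 0 < Real.log t := Real.log_pos ht1
    rw [norm_mul, norm_mul, Complex.norm_cpow_eq_rpow_re_of_pos ht0 _, Complex.norm_real, Real.norm_eq_abs,
      sub_re, show (2 : ℂ).re = 2 by simp, abs_of_pos (by positivity)]
    have hsplit : t ^ (z.re - 2) = t ^ (z.re - 1) * t⁻¹ := by
      rw [show z.re - 2 = (z.re - 1) + (-1) by ring, Real.rpow_add ht0, Real.rpow_neg_one]
    have hmono : t ^ (z.re - 1) ≤ x ^ (z.re - 1) :=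
      Real.antitoneOn_rpow_Ioi_of_exponent_nonpos (by linarith) (mem_Ioi.2 hx0) (mem_Ioi.2 ht0) ht.le
    rw [hsplit]
    have : t ^ (z.re - 1) * t⁻¹ * (1 / Real.log t ^ 3) ≤ x ^ (z.re - 1) * (t⁻¹ * (Real.log t ^ 3)⁻¹) := by
      rw [one_div, mul_assoc]
      exact mul_le_mul_of_nonneg_right hmono (by positivity)
    calc ‖c‖ * (t ^ (z.re - 1) * t⁻¹ * (1 / Real.log t ^ 3))
        ≤ ‖c‖ * (x ^ (z.re - 1) * (t⁻¹ * (Real.log t ^ 3)⁻¹)) := mul_le_mul_of_nonneg_left this (norm_nonneg _)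
      _ = _ := by ring
  calc ‖∫ t in Ioi x, c * ((t : ℂ) ^ (z - 2) * ((1 / Real.log t ^ 3 : ℝ) : ℂ))‖
      ≤ ∫ t in Ioi x, ‖c‖ * x ^ (z.re - 1) * (t⁻¹ * (Real.log t ^ 3)⁻¹) := by
        refine norm_integral_le_of_norm_le (hint.const_mul _) ?_
        exact (ae_restrict_iff' measurableSet_Ioi).2 (Eventually.of_forall hbound)
    _ = ‖c‖ * (x ^ (z.re - 1) / (2 * Real.log x ^ 2)) := by
        rw [MeasureTheory.integral_const_mul, hval]
        ring

/-- **RH-free per-zero bound** (Nicolas 2012, Lemma 2.2 (2.2), (2.6) with `t^{β−2} ≤ x^{β−1}t⁻¹`): for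
`0 < Re z < 1` and `x > 1`,
`‖F_z(x)/z‖ ≤ x^{Re z − 1}·(1/(|z||1−z| log x) + 2/(|1−z|² log² x))`. [cite: Nicolas2012, Lemma 2.2] -/
theorem norm_Fz_div_le_offline {z : ℂ} {x : ℝ} (hz : z.re < 1) (hx : 1 < x) :
    ‖Fz z x / z‖ ≤ x ^ (z.re - 1) * (1 / (‖z‖ * ‖1 - z‖ * Real.log x) + 2 / (‖1 - z‖ ^ 2 * Real.log x ^ 2)) := by
  by_cases hz0 : z = 0
  · subst hz0
    have hx0 : (0 : ℝ) < x := by linarith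
    have hlx : 0 < Real.log x := Real.log_pos hx
    simp
    positivity
  have hx0 : 0 < x := by linarith
  have hlx : 0 < Real.log x := Real.log_pos hx
  have h1z : 1 - z ≠ 0 := one_sub_ne_zero hz
  have hz1 : z - 1 ≠ 0 := fun h ↦ h1z (by linear_combination -h)
  have hn1z : 0 < ‖1 - z‖ := norm_pos_iff.2 h1z
  have hnz : 0 < ‖z‖ := norm_pos_iff.2 hz0
  have hxpow : ‖(x : ℂ) ^ (z - 1)‖ = x ^ (z.re - 1) := by
    rw [Complex.norm_cpow_eq_rpow_re_of_pos hx0, sub_re, one_re]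
  have hlogC : ‖(Real.log x : ℂ)‖ = Real.log x := by
    rw [Complex.norm_real, Real.norm_eq_abs, abs_of_pos hlx]
  -- the pieces
  have hA : ‖(x : ℂ) ^ (z - 1) / ((1 - z) * Real.log x) / z‖ = x ^ (z.re - 1) / (‖z‖ * ‖1 - z‖ * Real.log x) := by
    rw [norm_div, norm_div, norm_mul, hxpow, hlogC]
    field_simp
  have hB : ‖(x : ℂ) ^ (z - 1) / ((1 - z) * (Real.log x : ℂ) ^ 2)‖ = x ^ (z.re - 1) / (‖1 - z‖ * Real.log x ^ 2) := by
    rw [norm_div, norm_mul, norm_pow, hxpow, hlogC]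
  have hI : ‖∫ t in Ioi x, 2 / (z - 1) * ((t : ℂ) ^ (z - 2) * ((1 / Real.log t ^ 3 : ℝ) : ℂ))‖ ≤
      x ^ (z.re - 1) / (‖1 - z‖ * Real.log x ^ 2) := by
    refine (norm_integral_cpow_div_log_cube_le hz hx _).trans (le_of_eq ?_)
    rw [norm_div, Complex.norm_two, show ‖z - 1‖ = ‖1 - z‖ by rw [← norm_neg]; congr 1; ring]
    field_simp
  have hr : ‖rz z x‖ ≤ ‖z‖ / ‖1 - z‖ * (2 * (x ^ (z.re - 1) / (‖1 - z‖ * Real.log x ^ 2))) := by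
    rw [rz_eq hz hx, norm_mul, norm_neg, norm_div]
    refine mul_le_mul_of_nonneg_left ?_ (by positivity)
    calc _ ≤ ‖(x : ℂ) ^ (z - 1) / ((1 - z) * (Real.log x : ℂ) ^ 2)‖ +
          ‖∫ t in Ioi x, 2 / (z - 1) * ((t : ℂ) ^ (z - 2) * ((1 / Real.log t ^ 3 : ℝ) : ℂ))‖ := norm_add_le _ _
      _ ≤ _ := by rw [hB]; linarith
  have hrz : ‖rz z x / z‖ ≤ 2 * x ^ (z.re - 1) / (‖1 - z‖ ^ 2 * Real.log x ^ 2) := by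
    rw [norm_div, div_le_iff₀ hnz]
    refine hr.trans (le_of_eq ?_)
    field_simp
  rw [Fz_eq hz hx, add_div]
  calc _ ≤ ‖(x : ℂ) ^ (z - 1) / ((1 - z) * Real.log x) / z‖ + ‖rz z x / z‖ := norm_add_le _ _
    _ ≤ x ^ (z.re - 1) / (‖z‖ * ‖1 - z‖ * Real.log x) + 2 * x ^ (z.re - 1) / (‖1 - z‖ ^ 2 * Real.log x ^ 2) := by
        rw [hA]; gcongr
    _ = _ := by ring

/-! ### S2: per-zero majorants and the split sum -/

/-- `‖(m/ρ)·F_ρ(x)‖ = m·‖F_ρ(x)/ρ‖`. -/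
theorem norm_term_eq (ρ : Zeros) (x : ℝ) :
    ‖(riemannZetaZeroOrder (ρ : ℂ) : ℂ) / (ρ : ℂ) * Fz (ρ : ℂ) x‖ =
      (riemannZetaZeroOrder (ρ : ℂ) : ℝ) * ‖Fz (ρ : ℂ) x / (ρ : ℂ)‖ := by
  have hm := FordL33.order_pos ρ
  rw [show (riemannZetaZeroOrder (ρ : ℂ) : ℂ) / (ρ : ℂ) * Fz (ρ : ℂ) x =
      (riemannZetaZeroOrder (ρ : ℂ) : ℂ) * (Fz (ρ : ℂ) x / (ρ : ℂ)) by ring, norm_mul, Complex.norm_intCast,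
    abs_of_pos hm]

/-- ON-LINE per-zero majorant: for a zero with `Re ρ = 1/2` and `x > 1`,
`‖(m/ρ)F_ρ(x)‖ ≤ m·(1/(√x log x) + D_x)/|ρ|²` (Nicolas 2012, (2.2)–(2.3), `|1 − ρ| = |ρ|`). -/
theorem online_term_le (ρ : Zeros) {x : ℝ} (hx : 1 < x) (hre : (ρ : ℂ).re = 1 / 2) :
    ‖(riemannZetaZeroOrder (ρ : ℂ) : ℂ) / (ρ : ℂ) * Fz (ρ : ℂ) x‖ ≤
      (riemannZetaZeroOrder (ρ : ℂ) : ℝ) * ((1 / (Real.sqrt x * Real.log x) + Dx x) / ‖(ρ : ℂ)‖ ^ 2) := by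
  have hm := FordL33.order_pos ρ
  have hx0 : 0 < x := by linarith
  have hlx : 0 < Real.log x := Real.log_pos hx
  have hzlt : (ρ : ℂ).re < 1 := by rw [hre]; norm_num
  have hρ0 : (ρ : ℂ) ≠ 0 := FordL33.coe_ne_zero ρ
  have h1ρ : 1 - (ρ : ℂ) ≠ 0 := FordL33.one_sub_coe_ne_zero ρ
  have hnρ : 0 < ‖(ρ : ℂ)‖ := norm_pos_iff.2 hρ0
  have hn1 : ‖1 - (ρ : ℂ)‖ = ‖(ρ : ℂ)‖ := by
    have h := norm_div_one_sub_eq_one hre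
    rw [norm_div, div_eq_one_iff_eq (norm_ne_zero_iff.2 h1ρ)] at h
    exact h.symm
  rw [norm_term_eq]
  refine mul_le_mul_of_nonneg_left ?_ hm.le
  have hsqrt : x ^ ((ρ : ℂ).re - 1) = 1 / Real.sqrt x := by
    rw [hre, show (1 / 2 - 1 : ℝ) = -(1 / 2) by norm_num, Real.rpow_neg hx0.le, Real.sqrt_eq_rpow,
      inv_eq_one_div]
  have hA : ‖(x : ℂ) ^ ((ρ : ℂ) - 1) / ((1 - (ρ : ℂ)) * Real.log x) / (ρ : ℂ)‖ =
      1 / (Real.sqrt x * Real.log x) / ‖(ρ : ℂ)‖ ^ 2 := by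
    rw [norm_div, norm_div, norm_mul, Complex.norm_cpow_eq_rpow_re_of_pos hx0, sub_re, one_re, hsqrt,
      Complex.norm_real, Real.norm_eq_abs, abs_of_pos hlx, hn1]
    field_simp
  have hr : ‖rz (ρ : ℂ) x / (ρ : ℂ)‖ ≤ Dx x / ‖(ρ : ℂ)‖ ^ 2 := by
    rw [norm_div, div_le_iff₀ hnρ]
    refine (norm_rz_le hre hx).trans (le_of_eq ?_)
    rw [hn1, Dx]
    field_simp
  rw [Fz_eq hzlt hx, add_div]
  calc _ ≤ ‖(x : ℂ) ^ ((ρ : ℂ) - 1) / ((1 - (ρ : ℂ)) * Real.log x) / (ρ : ℂ)‖ + ‖rz (ρ : ℂ) x / (ρ : ℂ)‖ :=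
        norm_add_le _ _
    _ ≤ 1 / (Real.sqrt x * Real.log x) / ‖(ρ : ℂ)‖ ^ 2 + Dx x / ‖(ρ : ℂ)‖ ^ 2 := by rw [hA]; gcongr
    _ = _ := by ring

/-- OFF-LINE per-zero majorant (valid for EVERY zero): for `x > 1`,
`‖(m/ρ)F_ρ(x)‖ ≤ (1 + 2/log x)/(√x log x) · m·x^{Re ρ − 1/2}/γ²` (from `norm_Fz_div_le_offline`,
`|ρ|, |1−ρ| ≥ |γ|`). -/
theorem offline_term_le (ρ : Zeros) {x : ℝ} (hx : 1 < x) :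
    ‖(riemannZetaZeroOrder (ρ : ℂ) : ℂ) / (ρ : ℂ) * Fz (ρ : ℂ) x‖ ≤
      (1 + 2 / Real.log x) / (Real.sqrt x * Real.log x) *
        ((riemannZetaZeroOrder (ρ : ℂ) : ℝ) * x ^ ((ρ : ℂ).re - 1 / 2) / (ρ : ℂ).im ^ 2) := by
  have hm := FordL33.order_pos ρ
  have hx0 : 0 < x := by linarith
  have hlx : 0 < Real.log x := Real.log_pos hx
  have hsx : 0 < Real.sqrt x := Real.sqrt_pos.2 hx0
  have hzlt : (ρ : ℂ).re < 1 := ZetaZeros.riemannZetaNontrivialZeros.re_lt_one ρ.2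
  have hγ : 14 < |(ρ : ℂ).im| := FordL33.fourteen_lt_abs_im ρ
  have hγ0 : 0 < |(ρ : ℂ).im| := by linarith
  have hγρ : |(ρ : ℂ).im| ≤ ‖(ρ : ℂ)‖ := Complex.abs_im_le_norm _
  have hγ1 : |(ρ : ℂ).im| ≤ ‖1 - (ρ : ℂ)‖ := by
    have := Complex.abs_im_le_norm (1 - (ρ : ℂ))
    simpa using this
  have hsq : (ρ : ℂ).im ^ 2 = |(ρ : ℂ).im| ^ 2 := (sq_abs _).symm
  rw [norm_term_eq]
  have hper := norm_Fz_div_le_offline hzlt hx (z := (ρ : ℂ))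
  -- x^{β-1} = x^{β-1/2}/√x
  have hpow : x ^ ((ρ : ℂ).re - 1) = x ^ ((ρ : ℂ).re - 1 / 2) / Real.sqrt x := by
    rw [show (ρ : ℂ).re - 1 = ((ρ : ℂ).re - 1 / 2) + (-(1 / 2)) by ring, Real.rpow_add hx0,
      Real.rpow_neg hx0.le, Real.sqrt_eq_rpow]
    simp only [div_eq_mul_inv]
  have hxpos : 0 < x ^ ((ρ : ℂ).re - 1 / 2) := Real.rpow_pos_of_pos hx0 _
  -- the two reciprocal bounds
  have h1 : 1 / (‖(ρ : ℂ)‖ * ‖1 - (ρ : ℂ)‖ * Real.log x) ≤ 1 / (|(ρ : ℂ).im| ^ 2 * Real.log x) := by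
    apply one_div_le_one_div_of_le (by positivity)
    rw [pow_two]
    gcongr
  have h2 : 2 / (‖1 - (ρ : ℂ)‖ ^ 2 * Real.log x ^ 2) ≤ 2 / (|(ρ : ℂ).im| ^ 2 * Real.log x ^ 2) := by
    apply div_le_div_of_nonneg_left (by norm_num) (by positivity)
    gcongr
  calc (riemannZetaZeroOrder (ρ : ℂ) : ℝ) * ‖Fz (ρ : ℂ) x / (ρ : ℂ)‖
      ≤ (riemannZetaZeroOrder (ρ : ℂ) : ℝ) * (x ^ ((ρ : ℂ).re - 1) *
          (1 / (|(ρ : ℂ).im| ^ 2 * Real.log x) + 2 / (|(ρ : ℂ).im| ^ 2 * Real.log x ^ 2))) := by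
        refine mul_le_mul_of_nonneg_left (hper.trans ?_) hm.le
        rw [hpow]
        gcongr
    _ = (1 + 2 / Real.log x) / (Real.sqrt x * Real.log x) *
        ((riemannZetaZeroOrder (ρ : ℂ) : ℝ) * x ^ ((ρ : ℂ).re - 1 / 2) / (ρ : ℂ).im ^ 2) := by
        rw [hpow, hsq]
        field_simp

/-- The off-line weight family is summable (RH-free: `x^{β−1/2} ≤ √x`, `γ² ≥ |ρ|²/2`, Ford). -/
theorem summable_offWeight {x : ℝ} (hx : 1 < x) (T : ℝ) :
    Summable (fun ρ : Zeros ↦ (if T < |(ρ : ℂ).im| then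
        (riemannZetaZeroOrder (ρ : ℂ) : ℝ) * x ^ ((ρ : ℂ).re - 1 / 2) / (ρ : ℂ).im ^ 2 else 0)) := by
  have hx0 : 0 < x := by linarith
  have hS := FordL33.summable_order_div_norm_sq.mul_left (2 * Real.sqrt x)
  refine hS.of_nonneg_of_le (fun ρ ↦ ?_) (fun ρ ↦ ?_)
  · split_ifs
    · have := FordL33.order_pos ρ; positivity
    · exact le_rfl
  · have hm := FordL33.order_pos ρ
    have hγ : 14 < |(ρ : ℂ).im| := FordL33.fourteen_lt_abs_im ρ
    have hre0 : 0 < (ρ : ℂ).re := ZetaZeros.riemannZetaNontrivialZeros.re_pos ρ.2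
    have hre1 : (ρ : ℂ).re < 1 := ZetaZeros.riemannZetaNontrivialZeros.re_lt_one ρ.2
    have hpow : x ^ ((ρ : ℂ).re - 1 / 2) ≤ Real.sqrt x := by
      rw [Real.sqrt_eq_rpow]
      exact Real.rpow_le_rpow_of_exponent_le hx.le (by linarith)
    have hnorm : ‖(ρ : ℂ)‖ ^ 2 ≤ 2 * (ρ : ℂ).im ^ 2 := by
      rw [Complex.sq_norm, Complex.normSq_apply]
      have hγ2 : 14 ^ 2 < (ρ : ℂ).im ^ 2 := by
        calc (14 : ℝ) ^ 2 < |(ρ : ℂ).im| ^ 2 := by gcongr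
          _ = _ := sq_abs _
      nlinarith
    have hγpos : 0 < (ρ : ℂ).im ^ 2 := by
      have : 0 < |(ρ : ℂ).im| := by linarith
      rw [← sq_abs]; positivity
    have hnpos : 0 < ‖(ρ : ℂ)‖ ^ 2 := by
      have := FordL33.fourteen_lt_norm ρ; positivity
    split_ifs
    · calc (riemannZetaZeroOrder (ρ : ℂ) : ℝ) * x ^ ((ρ : ℂ).re - 1 / 2) / (ρ : ℂ).im ^ 2
          ≤ (riemannZetaZeroOrder (ρ : ℂ) : ℝ) * Real.sqrt x / (ρ : ℂ).im ^ 2 := by gcongr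
        _ ≤ (riemannZetaZeroOrder (ρ : ℂ) : ℝ) * Real.sqrt x * (2 / ‖(ρ : ℂ)‖ ^ 2) := by
            rw [div_eq_mul_one_div]
            refine mul_le_mul_of_nonneg_left ?_ (by positivity)
            rw [div_le_div_iff₀ hγpos hnpos]; linarith
        _ = 2 * Real.sqrt x * ((riemannZetaZeroOrder (ρ : ℂ) : ℝ) / ‖(ρ : ℂ)‖ ^ 2) := by ring
    · positivity

/-- **S2 PROVED** (g5; scratch `ZeroSplitBound`, spelled out): the partial-RH zero split — RH up to `T` enters ONLY through
`LiIndexSets.re_eq_half_of_abs_im_le`; everything else (Ford's `0.0463`, the per-zero bounds, summability) is RH-free.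
Under RH up to height `T` the zeros with `|γ| ≤ T` are on the line and contribute `≥ −0.0463·(1/(√x log x) + D_x)`
(Ford 2002 L.3.3), every zero with `|γ| > T` contributes `≥ −m·x^{β−1}(1 + 2/log x)/(γ² log x)`, in total
`≥ −(1 + 2/log x)·D/(√x log x)` given the off-line bound `D` (Nicolas 2012 Lemma 2.2/2.5 per zero). -/
theorem zeroSplitBound_holds :
    ∀ T x D : ℝ, 1 < x → RiemannHypothesisUpTo T →
    (∑' ρ : RHWave0.riemannZetaNontrivialZeros,
      (if T < |(ρ : ℂ).im| then
        (riemannZetaZeroOrder (ρ : ℂ) : ℝ) * x ^ ((ρ : ℂ).re - 1 / 2) / (ρ : ℂ).im ^ 2 else 0) ≤ D) →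
    Summable (fun ρ : Zeros ↦ (riemannZetaZeroOrder (ρ : ℂ) : ℂ) / (ρ : ℂ) * Fz (ρ : ℂ) x) →
      -(0.0463 * (1 / (Real.sqrt x * Real.log x) + Dx x)
          + (1 + 2 / Real.log x) * D * (1 / (Real.sqrt x * Real.log x))) ≤
        (-∑' ρ : Zeros, (riemannZetaZeroOrder (ρ : ℂ) : ℂ) / (ρ : ℂ) * Fz (ρ : ℂ) x).re := by
  intro T x D hx hT hoff hsum
  have hx0 : 0 < x := by linarith
  have hlx : 0 < Real.log x := Real.log_pos hx
  have hsx : 0 < Real.sqrt x := Real.sqrt_pos.2 hx0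
  set a : ℝ := 1 / (Real.sqrt x * Real.log x) + Dx x with ha
  set c : ℝ := (1 + 2 / Real.log x) / (Real.sqrt x * Real.log x) with hc
  have ha0 : 0 ≤ a := by rw [ha]; have := Dx_pos hx; positivity
  have hc0 : 0 ≤ c := by rw [hc]; positivity
  -- the families
  set f : Zeros → ℂ := fun ρ ↦ (riemannZetaZeroOrder (ρ : ℂ) : ℂ) / (ρ : ℂ) * Fz (ρ : ℂ) x with hf
  set gon : Zeros → ℝ := fun ρ ↦ if |(ρ : ℂ).im| ≤ T then
      (riemannZetaZeroOrder (ρ : ℂ) : ℝ) * (a / ‖(ρ : ℂ)‖ ^ 2) else 0 with hgon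
  set w : Zeros → ℝ := fun ρ ↦ if T < |(ρ : ℂ).im| then
      (riemannZetaZeroOrder (ρ : ℂ) : ℝ) * x ^ ((ρ : ℂ).re - 1 / 2) / (ρ : ℂ).im ^ 2 else 0 with hw
  -- pointwise: ‖f ρ‖ ≤ gon ρ + c * w ρ
  have hpt : ∀ ρ, ‖f ρ‖ ≤ gon ρ + c * w ρ := by
    intro ρ
    by_cases hρ : |(ρ : ℂ).im| ≤ T
    · have hre : (ρ : ℂ).re = 1 / 2 := LiIndexSets.re_eq_half_of_abs_im_le hT ρ.2 hρ
      have h := online_term_le ρ hx hre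
      have hwz : w ρ = 0 := by rw [hw]; simp [not_lt.2 hρ]
      have hg : gon ρ = (riemannZetaZeroOrder (ρ : ℂ) : ℝ) * (a / ‖(ρ : ℂ)‖ ^ 2) := by rw [hgon]; simp [hρ]
      rw [hwz, hg, mul_zero, add_zero, ha]
      exact h
    · have hlt : T < |(ρ : ℂ).im| := not_le.1 hρ
      have h := offline_term_le ρ hx
      have hg : gon ρ = 0 := by rw [hgon]; simp [hρ]
      have hwρ : w ρ = (riemannZetaZeroOrder (ρ : ℂ) : ℝ) * x ^ ((ρ : ℂ).re - 1 / 2) / (ρ : ℂ).im ^ 2 := by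
        rw [hw]; simp [hlt]
      rw [hg, zero_add, hwρ, hc]
      exact h
  -- summability
  have hFord := FordL33.summable_order_div_norm_sq
  have hgon_s : Summable gon := by
    refine (hFord.mul_left a).of_nonneg_of_le (fun ρ ↦ ?_) (fun ρ ↦ ?_)
    · simp only [hgon]; split_ifs
      · have := FordL33.order_pos ρ; positivity
      · exact le_rfl
    · have hm := FordL33.order_pos ρ
      simp only [hgon]; split_ifs
      · exact le_of_eq (by ring)
      · positivity
  have hw_s : Summable w := summable_offWeight hx T
  have hmaj_s : Summable (fun ρ ↦ gon ρ + c * w ρ) := hgon_s.add (hw_s.mul_left c)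
  -- sums
  have hgon_le : ∑' ρ, gon ρ ≤ a * 0.0463 := by
    have h1 : ∑' ρ, gon ρ ≤ ∑' ρ : Zeros, a * ((riemannZetaZeroOrder (ρ : ℂ) : ℝ) / ‖(ρ : ℂ)‖ ^ 2) := by
      refine hgon_s.tsum_le_tsum (fun ρ ↦ ?_) (hFord.mul_left a)
      have hm := FordL33.order_pos ρ
      simp only [hgon]; split_ifs
      · exact le_of_eq (by ring)
      · positivity
    rw [tsum_mul_left] at h1
    exact h1.trans (mul_le_mul_of_nonneg_left tsum_zeroOrder_div_norm_sq_le ha0)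
  have hw_le : ∑' ρ, c * w ρ ≤ c * D := by
    rw [tsum_mul_left]
    exact mul_le_mul_of_nonneg_left hoff hc0
  have hnorm_s : Summable (fun ρ ↦ ‖f ρ‖) :=
    hmaj_s.of_nonneg_of_le (fun ρ ↦ norm_nonneg _) hpt
  have hre_s : Summable (fun ρ ↦ (f ρ).re) := (Complex.hasSum_re hsum.hasSum).summable
  have key : ∑' ρ, (f ρ).re ≤ a * 0.0463 + c * D := by
    calc ∑' ρ, (f ρ).re ≤ ∑' ρ, ‖f ρ‖ := hre_s.tsum_le_tsum (fun ρ ↦ Complex.re_le_norm _) hnorm_s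
      _ ≤ ∑' ρ, (gon ρ + c * w ρ) := hnorm_s.tsum_le_tsum hpt hmaj_s
      _ = ∑' ρ, gon ρ + ∑' ρ, c * w ρ := hgon_s.tsum_add (hw_s.mul_left c)
      _ ≤ a * 0.0463 + c * D := add_le_add hgon_le hw_le
  have hre_eq : (-∑' ρ : Zeros, f ρ).re = -∑' ρ, (f ρ).re := by
    rw [Complex.neg_re, Complex.re_tsum hsum]
  rw [hre_eq]
  have e : 0.0463 * (1 / (Real.sqrt x * Real.log x) + Dx x)
      + (1 + 2 / Real.log x) * D * (1 / (Real.sqrt x * Real.log x)) = a * 0.0463 + c * D := by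
    rw [ha, hc]; ring
  linarith

end Summit.RiemannHypothesis.RiemannHypothesis.Theorems.Splittings.RobinFiniteE1c

end
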